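import Summits.QuantumFields.YangMills.Theorems.ColdStartUniversalityLatticeLangevinWilsonAutocorrelationLogConvex
import HarnessLib

/-!
# Route `ColdStartUniversality` (fixed-cut-off `L²(μ_{β'})` package): A UNIFORM BOUND ON INTEGRATED AUTOCORRELATION TIMES IS A
# SPECTRAL GAP — `sup_G τ_int(G) ≤ A ⇒ ∫ (κ_t G − μG)² dμ ≤ e^{−2t/A} Var_μ(G)`, optimal constant, no spectral theorem

Helper file (seat `ym-line-csu-p1`, g17; `--supports stmt-QuantumFields-27363`).  Fourth part of the semigroup-form Poincaré package.
The route's kill-shape and its instrument rows (kit j298062, REPORT-ym-csu-instr-1) speak of INTEGRATED AUTOCORRELATION TIMES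
`τ_int(G) = ∫₀^∞ ⟨G₀, κ_t G₀⟩_μ dt / Var_μ(G)` of unit observables in physical units; g16 proved the fixed-cut-off sandwich
`Var/𝓔 ≤ τ_int ≤ 1/c` (`…AutocorrelationTime`).  This file proves the CONVERSE direction «uniform τ_int bound ⇒ gap», so that at
every cut-off, for the reversible SZZ kernels and continuous observables,

  (H1-type `L²` decay at rate `λ`)  ⟺  (Poincaré for the semigroup Dirichlet form, constant `1/λ`)  ⟺  (`sup_G τ_int(G) ≤ 1/λ`),

all with the SAME constant and all by elementary (log-)convexity of `u ↦ Φ_G(u) = ⟨G₀, κ_u G₀⟩_μ` (tools in `…AutocorrelationLogConvex`):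

* ★★ `semigroupPoincare_of_autocorrelation_integral_le` — if `∫₀^{T'} ⟨H₀, κ_t H₀⟩ dt ≤ A Var(H)` for every continuous `H` and every
  `T' ≥ 0`, then every continuous `G` satisfies the semigroup-form Poincaré inequality with constant `A`: for every `η > 0` some `h > 0`
  has `(1/A − η) Var(G) ≤ 𝓔_h(G)` (with `q = Φ(T)/Φ(0)`: `T Φ(0) Σ_{k≤N} q^k ≤ T Σ_k Φ(kT) ≤ ∫₀^{NT}Φ ≤ AΦ(0)` forces `q < 1` and
  `Tq/(1−q) ≤ A`, i.e. `𝓔_T(G) ≥ (q/A) Var(G)`, and `q → 1` as `T ↓ 0`).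
* ★★ `integral_sq_transition_sub_le_exp_of_autocorrelation_integral_le` — hence `∫ (κ_tG − μG)² dμ ≤ e^{−2t/A} Var_μ(G)`
  (by `integral_sq_transition_sub_le_exp_of_semigroupPoincare`): A UNIFORM `τ_int` BOUND `A` IS AN `L²` GAP `1/A` — the optimal constant
  (for an eigenfunction, `τ_int = 1/λ`); with g16's `integral_autocorrelation_le` (`τ_int ≤ 1/c` from the rate `c`), at fixed cut-off
  `sup_G τ_int(G) = 1/(best L² rate)` exactly, kernel-checked without spectral theory.

THEOREMS ONLY, no definition, no sorry.  HONEST FRAMING: RECORD-rung R3 plumbing at FIXED cut-off (the K-uniform, physical-units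
reading is in the sequel `…UniformColdStartMixingOfAutocorrelationTime`); nothing K-uniform is proved; no crux, rung or summit
statement is proved; the Yang–Mills mass gap is NOT proved.
-/

set_option autoImplicit false

noncomputable section

namespace Summit.QuantumFields.YangMills.Theorems.ColdStartUniversality

open MeasureTheory ProbabilityTheory Filter Set Topology Finset
open scoped BigOperators NNReal ENNReal
open Literature.Probability.Process Literature.MathematicalPhysics.QuantumFieldTheory
open Literature.MathematicalPhysics.QuantumLattice (fundamentalRep fundamentalLatticeRep continuous_fundamentalRep)

variable {L : ℕ} [NeZero L]

/-! ## §2. A uniform bound on integrated autocorrelation times is a Poincaré inequality for the semigroup Dirichlet form -/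

/-- ★★ **`sup_G τ_int(G) ≤ A` ⇒ semigroup-form Poincaré with constant `A`.**  If every continuous `H` has
`∫₀^{T'} ⟨H₀, κ_t H₀⟩_μ dt ≤ A · Var_μ(H)` for all `T' ≥ 0` (`H₀ = H − μH`; the integrand is `∫ (H − μH)(κ_tH − μH) dμ`), then every
continuous `G` satisfies, for every `η > 0`, `(1/A − η) Var_μ(G) ≤ h⁻¹(∫ G² dμ − ∫ G κ_h G dμ)` for some `h > 0`.  Proof: with
`Φ(u) = ⟨G₀, κ_u G₀⟩`, `q = Φ(T)/Φ(0)`: `T Φ(0) Σ_{k=1}^{N} q^k ≤ T Σ Φ(kT) ≤ ∫₀^{NT} Φ ≤ A Φ(0)` (`integral_mul_transition_nat_mul_ge`,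
`mul_sum_le_intervalIntegral_autocorrelation`), so `q < 1` and `T q/(1−q) ≤ A`, i.e. `(Φ(0) − Φ(T))/T ≥ (q/A) Φ(0)`; and `q → 1` as
`T ↓ 0`. [cite: BakryGentilLedoux2014, Thm 4.2.5 with §4.2 (spectral gap = inverse relaxation time)] -/
theorem semigroupPoincare_of_autocorrelation_integral_le (L : ℕ) [NeZero L] (β' : ℝ)
    (κ : ℝ≥0 → Kernel (GaugeConfig 3 L (Matrix.specialUnitaryGroup (Fin 2) ℂ))
      (GaugeConfig 3 L (Matrix.specialUnitaryGroup (Fin 2) ℂ))) [∀ t, IsMarkovKernel (κ t)]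
    (hreal : ∀ (t : ℝ≥0) (x : GaugeConfig 3 L (Matrix.specialUnitaryGroup (Fin 2) ℂ))
        (Ω : Type) [MeasurableSpace Ω] (P : Measure Ω) [IsProbabilityMeasure P]
        (W : ℝ≥0 → Ω → (Edge 3 L × NoiseIdx 2 → ℝ)) (hW : IsFlatBrownian W P)
        (U : ℝ≥0 → Ω → GaugeConfig 3 L (Matrix.specialUnitaryGroup (Fin 2) ℂ)),
        (∀ ω, U 0 ω = x) →
        (latticeLangevinDynamics (fundamentalLatticeRep 2) β').IsSolution (fundamentalRep (Fin 2))
          hW.natFiltration P W U →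
        κ t x = P.map (U t))
    {A : ℝ} (hA : 0 < A)
    (hτ : ∀ H : GaugeConfig 3 L (Matrix.specialUnitaryGroup (Fin 2) ℂ) → ℝ, Continuous H → ∀ T' : ℝ, 0 ≤ T' →
      ∫ t in (0 : ℝ)..T', ∫ x, (H x - ∫ z, H z ∂(wilsonMeasure (d := 3) (L := L) (fundamentalRep (Fin 2)) β')) *
          ((∫ y, H y ∂(κ t.toNNReal x)) - ∫ z, H z ∂(wilsonMeasure (d := 3) (L := L) (fundamentalRep (Fin 2)) β'))
          ∂(wilsonMeasure (d := 3) (L := L) (fundamentalRep (Fin 2)) β') ≤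
        A * ∫ x, (H x - ∫ z, H z ∂(wilsonMeasure (d := 3) (L := L) (fundamentalRep (Fin 2)) β')) ^ 2
          ∂(wilsonMeasure (d := 3) (L := L) (fundamentalRep (Fin 2)) β'))
    {G : GaugeConfig 3 L (Matrix.specialUnitaryGroup (Fin 2) ℂ) → ℝ} (hG : Continuous G) {η : ℝ} (hη : 0 < η) :
    ∃ h : ℝ≥0, 0 < h ∧
      (A⁻¹ - η) * ∫ x, (G x - ∫ z, G z ∂(wilsonMeasure (d := 3) (L := L) (fundamentalRep (Fin 2)) β')) ^ 2
          ∂(wilsonMeasure (d := 3) (L := L) (fundamentalRep (Fin 2)) β') ≤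
        (h : ℝ)⁻¹ * ((∫ x, G x * G x ∂(wilsonMeasure (d := 3) (L := L) (fundamentalRep (Fin 2)) β')) -
          ∫ x, G x * (∫ y, G y ∂(κ h x)) ∂(wilsonMeasure (d := 3) (L := L) (fundamentalRep (Fin 2)) β')) := by
  classical
  haveI := secondCountableTopology_su2
  haveI := borelSpace_config L
  set μ : Measure (GaugeConfig 3 L (Matrix.specialUnitaryGroup (Fin 2) ℂ)) :=
    wilsonMeasure (d := 3) (L := L) (fundamentalRep (Fin 2)) β' with hμ
  haveI : IsProbabilityMeasure μ :=
    isProbabilityMeasure_wilsonMeasure (d := 3) (L := L) (fundamentalRep (Fin 2)) (continuous_fundamentalRep (Fin 2)) β'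
  set m : ℝ := ∫ z, G z ∂μ with hm
  set Vr : ℝ := ∫ x, (G x - m) ^ 2 ∂μ with hVr
  have hVr0 : 0 ≤ Vr := integral_nonneg fun x => sq_nonneg _
  -- trivial cases
  by_cases htriv : (A⁻¹ - η) * Vr ≤ 0
  · exact ⟨1, one_pos, htriv.trans (dirichletScale_nonneg L β' κ hreal 1 hG)⟩
  have hVpos : 0 < Vr := by
    rcases hVr0.lt_or_eq with h | h
    · exact h
    · exfalso; apply htriv; rw [← h, mul_zero]
  -- the centred observable and its autocorrelation function
  set G₀ : GaugeConfig 3 L (Matrix.specialUnitaryGroup (Fin 2) ℂ) → ℝ := fun x => G x - m with hG₀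
  have hG₀c : Continuous G₀ := hG.sub continuous_const
  obtain ⟨M, hM0, hM⟩ := exists_abs_le_of_continuous hG
  have hGi : ∀ (ν : Measure (GaugeConfig 3 L (Matrix.specialUnitaryGroup (Fin 2) ℂ))) [IsProbabilityMeasure ν],
      Integrable G ν := fun ν _ =>
    Integrable.of_bound hG.aestronglyMeasurable M (Eventually.of_forall fun z => by rw [Real.norm_eq_abs]; exact hM z)
  have hκG₀ : ∀ (u : ℝ≥0) x, ∫ y, G₀ y ∂(κ u x) = (∫ y, G y ∂(κ u x)) - m := by
    intro u x
    simp only [hG₀]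
    rw [integral_sub (hGi _) (integrable_const m), integral_const, probReal_univ, one_smul]
  set Φ : ℝ≥0 → ℝ := fun u => ∫ x, G₀ x * (∫ y, G₀ y ∂(κ u x)) ∂μ with hΦ
  have hΦc : Continuous Φ := continuous_integral_mul_transition L β' κ hreal hG₀c hG₀c
  have hκ0 : κ 0 = Kernel.id := transitionKernel_zero_eq_id L β' κ hreal
  have hG₀sq : ∫ x, G₀ x * G₀ x ∂μ = Vr := integral_congr_ae (Eventually.of_forall fun x => by simp only [hG₀]; ring)
  have hΦ0 : Φ 0 = Vr := by
    simp only [hΦ, hκ0, Kernel.id_apply, integral_dirac]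
    exact hG₀sq
  have hΦ0pos : 0 < ∫ x, G₀ x * G₀ x ∂μ := by rw [hG₀sq]; exact hVpos
  -- the hypothesis for `H = G`, with the integrand identified with `Φ`
  have hG₀x : ∀ x, G₀ x = G x - m := fun x => rfl
  have hτG : ∀ T' : ℝ, 0 ≤ T' → ∫ t in (0 : ℝ)..T', Φ t.toNNReal ≤ A * Vr := by
    intro T' hT'
    have h := hτ G hG T' hT'
    simp only [← hm] at h
    have e : ∀ t : ℝ, ∫ x, (G x - m) * ((∫ y, G y ∂(κ t.toNNReal x)) - m) ∂μ = Φ t.toNNReal := by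
      intro t
      simp only [hΦ]
      refine integral_congr_ae (Eventually.of_forall fun x => ?_)
      beta_reduce
      rw [hκG₀ t.toNNReal x, hG₀x x]
    simp_rw [e] at h
    exact h
  -- choose the grid step `T > 0` with `Φ T ≥ (1 − Aη) Vr`
  have hev : ∀ᶠ u : ℝ≥0 in 𝓝 0, dist (Φ u) (Φ 0) < A * η * Vr :=
    Metric.tendsto_nhds.1 (hΦc.tendsto 0) _ (by positivity)
  obtain ⟨δ, hδ, hball⟩ := Metric.eventually_nhds_iff.1 hev
  set T : ℝ≥0 := ⟨δ / 2, by positivity⟩ with hT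
  have hTv : (T : ℝ) = δ / 2 := rfl
  have hTpos : (0 : ℝ) < T := by rw [hTv]; positivity
  have hTpos' : 0 < T := by exact_mod_cast hTpos
  have hTd : dist T 0 < δ := by
    rw [NNReal.dist_eq, NNReal.coe_zero, sub_zero, hTv, abs_of_pos (by positivity)]; linarith
  have hclose : |Φ T - Vr| < A * η * Vr := by
    have h := hball hTd; rwa [Real.dist_eq, hΦ0] at h
  refine ⟨T, hTpos', ?_⟩
  -- `q = Φ T / Vr`
  set q : ℝ := Φ T / Vr with hq
  have hq0 : 0 ≤ q := div_nonneg (integral_mul_transition_self_nonneg L β' κ hreal T hG₀c) hVr0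
  have hqV : Φ T = q * Vr := by rw [hq, div_mul_cancel₀ _ hVpos.ne']
  -- geometric lower bound `Vr q^k ≤ Φ(kT)` and the Riemann sum: `T Vr Σ_{k<N} q^{k+1} ≤ A Vr`
  have hgeom : ∀ N : ℕ, (T : ℝ) * ∑ k ∈ Finset.range N, Vr * q ^ (k + 1) ≤ A * Vr := by
    intro N
    have h1 : ∀ k ∈ Finset.range N, Vr * q ^ (k + 1) ≤ ∫ x, G₀ x * (∫ y, G₀ y ∂(κ (((k : ℝ≥0) + 1) * T) x)) ∂μ := by
      intro k _
      have h := integral_mul_transition_nat_mul_ge L β' κ hreal T hG₀c hΦ0pos (k + 1)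
      rw [hG₀sq] at h
      have e : (((k + 1 : ℕ) : ℝ≥0)) * T = ((k : ℝ≥0) + 1) * T := by push_cast; ring
      rw [e] at h
      simpa only [hΦ, hq] using h
    have h2 := mul_sum_le_intervalIntegral_autocorrelation L β' κ hreal T hG₀c N
    have h3 := hτG ((N : ℝ) * T) (by positivity)
    calc (T : ℝ) * ∑ k ∈ Finset.range N, Vr * q ^ (k + 1)
        ≤ (T : ℝ) * ∑ k ∈ Finset.range N, ∫ x, G₀ x * (∫ y, G₀ y ∂(κ (((k : ℝ≥0) + 1) * T) x)) ∂μ :=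
          mul_le_mul_of_nonneg_left (Finset.sum_le_sum h1) T.2
      _ ≤ ∫ t in (0 : ℝ)..((N : ℝ) * T), Φ t.toNNReal := h2
      _ ≤ A * Vr := h3
  have hsumq : ∀ N : ℕ, ∑ k ∈ Finset.range N, q ^ (k + 1) ≤ A / T := by
    intro N
    have h := hgeom N
    rw [← Finset.mul_sum] at h
    rw [le_div_iff₀ hTpos]
    have : (T : ℝ) * (Vr * ∑ k ∈ Finset.range N, q ^ (k + 1)) ≤ A * Vr := h
    nlinarith [this, hVpos]
  -- `q < 1`
  have hq1 : q < 1 := by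
    by_contra hge
    have hge' : 1 ≤ q := not_lt.1 hge
    obtain ⟨N, hN⟩ := exists_nat_gt (A / T)
    have h := hsumq N
    have hN' : (N : ℝ) ≤ ∑ k ∈ Finset.range N, q ^ (k + 1) := by
      have : ∑ k ∈ Finset.range N, (1 : ℝ) ≤ ∑ k ∈ Finset.range N, q ^ (k + 1) :=
        Finset.sum_le_sum fun k _ => one_le_pow₀ hge'
      simpa using this
    linarith
  -- `Σ q^{k+1} = q/(1−q) ≤ A/T`
  have hgeomsum : q / (1 - q) ≤ A / T := by
    have hs : HasSum (fun k : ℕ => q ^ (k + 1)) (q * (1 - q)⁻¹) := by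
      have h := (hasSum_geometric_of_lt_one hq0 hq1).mul_left q
      have e : (fun k : ℕ => q * q ^ k) = fun k => q ^ (k + 1) := by funext k; rw [pow_succ]; ring
      rwa [e] at h
    rw [div_eq_mul_inv, ← hs.tsum_eq]
    exact Real.tsum_le_of_sum_range_le (fun k => pow_nonneg hq0 _) hsumq
  -- hence `(1 − q)/T ≥ q/A ≥ 1/A − η`
  have h1q : 0 < 1 - q := by linarith
  have hmain : (A⁻¹ - η) * Vr ≤ (T : ℝ)⁻¹ * (Vr - Φ T) := by
    have hqA : q ≥ 1 - A * η := by
      have := (abs_lt.1 hclose).1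
      rw [hqV] at this
      -- `-(AηVr) < qVr − Vr` ⇒ `q > 1 − Aη`
      have h' : (1 - A * η) * Vr < q * Vr := by linarith
      exact (lt_of_mul_lt_mul_right h' hVr0).le
    have hstep : (T : ℝ) * q ≤ A * (1 - q) := by
      rw [div_le_div_iff₀ h1q hTpos] at hgeomsum
      linarith
    -- `(1−q)/T ≥ q/A`
    have h2 : q / A ≤ (1 - q) / T := by
      rw [div_le_div_iff₀ hA hTpos]; linarith
    have h3 : A⁻¹ - η ≤ q / A := by
      rw [div_eq_mul_inv]
      have : (1 - A * η) * A⁻¹ ≤ q * A⁻¹ := mul_le_mul_of_nonneg_right hqA (inv_nonneg.2 hA.le)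
      have e : (1 - A * η) * A⁻¹ = A⁻¹ - η := by field_simp
      linarith [this, e]
    rw [hqV]
    calc (A⁻¹ - η) * Vr ≤ (q / A) * Vr := mul_le_mul_of_nonneg_right h3 hVr0
      _ ≤ ((1 - q) / T) * Vr := mul_le_mul_of_nonneg_right h2 hVr0
      _ = (T : ℝ)⁻¹ * (Vr - q * Vr) := by rw [div_eq_inv_mul]; ring
  rw [dirichletScale_eq_centred L β' κ hreal T hG]
  have eΦT : ∫ x, (G x - m) * (∫ y, (G y - m) ∂(κ T x)) ∂μ = Φ T := rfl
  have eV : ∫ x, (G x - m) * (G x - m) ∂μ = Vr := integral_congr_ae (Eventually.of_forall fun x => by ring)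
  rw [eV, eΦT]
  exact hmain

/-- ★★ **A uniform bound on integrated autocorrelation times is an `L²(μ_{β'})` spectral gap, optimal constant**: if
`∫₀^{T'} ⟨H₀, κ_tH₀⟩_μ dt ≤ A Var_μ(H)` for every continuous `H` and `T' ≥ 0`, then `∫ (κ_tG − μG)² dμ ≤ e^{−2t/A} Var_μ(G)` for every
continuous `G` and every lattice time `t` (`semigroupPoincare_of_autocorrelation_integral_le` +
`integral_sq_transition_sub_le_exp_of_semigroupPoincare`). [cite: BakryGentilLedoux2014, Thm 4.2.5] -/
theorem integral_sq_transition_sub_le_exp_of_autocorrelation_integral_le (L : ℕ) [NeZero L] (β' : ℝ)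
    (κ : ℝ≥0 → Kernel (GaugeConfig 3 L (Matrix.specialUnitaryGroup (Fin 2) ℂ))
      (GaugeConfig 3 L (Matrix.specialUnitaryGroup (Fin 2) ℂ))) [∀ t, IsMarkovKernel (κ t)]
    (hreal : ∀ (t : ℝ≥0) (x : GaugeConfig 3 L (Matrix.specialUnitaryGroup (Fin 2) ℂ))
        (Ω : Type) [MeasurableSpace Ω] (P : Measure Ω) [IsProbabilityMeasure P]
        (W : ℝ≥0 → Ω → (Edge 3 L × NoiseIdx 2 → ℝ)) (hW : IsFlatBrownian W P)
        (U : ℝ≥0 → Ω → GaugeConfig 3 L (Matrix.specialUnitaryGroup (Fin 2) ℂ)),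
        (∀ ω, U 0 ω = x) →
        (latticeLangevinDynamics (fundamentalLatticeRep 2) β').IsSolution (fundamentalRep (Fin 2))
          hW.natFiltration P W U →
        κ t x = P.map (U t))
    {A : ℝ} (hA : 0 < A)
    (hτ : ∀ H : GaugeConfig 3 L (Matrix.specialUnitaryGroup (Fin 2) ℂ) → ℝ, Continuous H → ∀ T' : ℝ, 0 ≤ T' →
      ∫ t in (0 : ℝ)..T', ∫ x, (H x - ∫ z, H z ∂(wilsonMeasure (d := 3) (L := L) (fundamentalRep (Fin 2)) β')) *
          ((∫ y, H y ∂(κ t.toNNReal x)) - ∫ z, H z ∂(wilsonMeasure (d := 3) (L := L) (fundamentalRep (Fin 2)) β'))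
          ∂(wilsonMeasure (d := 3) (L := L) (fundamentalRep (Fin 2)) β') ≤
        A * ∫ x, (H x - ∫ z, H z ∂(wilsonMeasure (d := 3) (L := L) (fundamentalRep (Fin 2)) β')) ^ 2
          ∂(wilsonMeasure (d := 3) (L := L) (fundamentalRep (Fin 2)) β'))
    {G : GaugeConfig 3 L (Matrix.specialUnitaryGroup (Fin 2) ℂ) → ℝ} (hG : Continuous G) (t : ℝ≥0) :
    ∫ x, ((∫ y, G y ∂(κ t x)) - ∫ z, G z ∂(wilsonMeasure (d := 3) (L := L) (fundamentalRep (Fin 2)) β')) ^ 2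
        ∂(wilsonMeasure (d := 3) (L := L) (fundamentalRep (Fin 2)) β') ≤
      Real.exp (-2 * A⁻¹ * t) *
        ∫ x, (G x - ∫ z, G z ∂(wilsonMeasure (d := 3) (L := L) (fundamentalRep (Fin 2)) β')) ^ 2
          ∂(wilsonMeasure (d := 3) (L := L) (fundamentalRep (Fin 2)) β') :=
  integral_sq_transition_sub_le_exp_of_semigroupPoincare L β' κ hreal
    (fun _ hG' _ hη => semigroupPoincare_of_autocorrelation_integral_le L β' κ hreal hA hτ hG' hη) hG t

end Summit.QuantumFields.YangMills.Theorems.ColdStartUniversality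

end
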